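import Literature.NumberTheory.Transcendental.KZDominatedFamilyRelations
import Literature.NumberTheory.Transcendental.SemialgebraicVolume
import Summits.KontsevichZagierPeriods.KontsevichZagierPeriods.Theses.MultivaluedCoV
import Summits.KontsevichZagierPeriods.KontsevichZagierPeriods.Theorems.MultivaluedCoVTwoIsogenyAreaIdentityXMap

/-!
# `TwoIsogenyAreaIdentity`: `∬ dA/|x³+ax²+bx| = 2 ∬ dA/|X³ − 2aX² + (a²−4b)X|` in the KZ calculus
(item stmt-KontsevichZagierPeriods-2879, route MultivaluedCoV)

For `a, b ∈ ℚ` with `b ≠ 0` (and `a² − 4b ≠ 0`, not used by the derivation) and ANY integral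
representations `r = [ℝ², 1/‖P(x + iy)‖]`, `r' = [ℝ², 1/‖Q(X + iY)‖]` (`P(z) = z³ + az² + bz`,
`Q(w) = w³ − 2aw² + (a² − 4b)w`) we prove `KZ.of r − 2 • KZ.of r' ∈ KZ.relations` by five moves
of Kontsevich–Zagier's rules (1a) and (2):

1. `[r] ≡ [r | σ₀ ∪ σ₁]` — the complement `{x·y·((x²+y²)² − b²) = 0}` is a null algebraic set
   (`KZ.IntegralRep.of_sub_of_restrict_mem_relations`, `volume_setOf_aeval_eq_zero`);
2. `[r | σ₀ ∪ σ₁] = [r | σ₀] + [r | σ₁]` (domain additivity, disjoint sheets);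
3. and 4. `[r | σᵢ] − [r' | T] ∈ changeOfVariablesRel` along the x-map `R(z) = z + a + b/z` of the
   2-isogeny (`Φ = e⁻¹ ∘ R ∘ e`): semialgebraic, differentiable with Jacobian `‖R'‖²`, injective
   on each sheet and onto `T = {Re ≠ a, Im ≠ 0}`, with `1/‖P‖ = (1/‖Q‖ ∘ R)·‖R'‖²`
   (file `MultivaluedCoVTwoIsogenyAreaIdentityXMap.lean`);
5. `[r'] ≡ [r' | T]` — the complement `{(X − a)·Y = 0}` is null.

So `∬ dA/|P| = 2∬ dA/|Q|` is accessible, as the route predicted ("immediate from TwoIsogenySheets +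
SheetTransfer"); the proof here is direct and does not wait for those cruxes — it is the `N = 2`
instance of the sheet-transfer engine with non-overlapping sheets chosen so that every
intermediate representation is a restriction of `r` or `r'` (no integrability side conditions).

References: M. Kontsevich, D. Zagier, *Periods* (2001), §1.2 rules (1), (2); J. H. Silverman,
*The Arithmetic of Elliptic Curves* (2009), III.4.5.
-/

noncomputable section

open Complex Set MeasureTheory MvPolynomial
open Literature.NumberTheory.Transcendental Literature.ModelTheory.ExponentialFields

namespace Summit.KontsevichZagierPeriods.MultivaluedCoV.TwoIsogenyAreaIdentity

/-! ### Semialgebraic and null sets of the dissection -/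

/-- The zero set of a rational polynomial on the plane that does not vanish identically is null.
[cite: CaronTraynor2005, Theorem (p. 1)] -/
theorem volume_setOf_aeval_eq_zero_of_ne (q : MvPolynomial (Fin 2) ℚ) (x : Fin 2 → ℝ)
    (hx : aeval x q ≠ 0) : volume {p : Fin 2 → ℝ | aeval p q = 0} = 0 := by
  refine volume_setOf_aeval_eq_zero q fun h0 => hx ?_
  rw [MvPolynomial.aeval_def, ← MvPolynomial.eval_map, h0, map_zero]

/-- The complement of the two sheets, contained in `{x = 0} ∪ {y = 0} ∪ {(x² + y²)² = b²}`, is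
null (`b ≠ 0`). [folklore] -/
theorem volume_compl_sheets (b : ℚ) (hb : b ≠ 0) :
    volume ({p : Fin 2 → ℝ | p 0 ≠ 0 ∧ p 1 ≠ 0 ∧ (b : ℝ) ^ 2 < (p 0 ^ 2 + p 1 ^ 2) ^ 2} ∪
      {p | p 0 ≠ 0 ∧ p 1 ≠ 0 ∧ (p 0 ^ 2 + p 1 ^ 2) ^ 2 < (b : ℝ) ^ 2})ᶜ = 0 := by
  have h0 : volume {p : Fin 2 → ℝ | p 0 = 0} = 0 := by
    have := volume_setOf_aeval_eq_zero_of_ne (X 0) ![1, 1] (by simp)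
    simpa using this
  have h1 : volume {p : Fin 2 → ℝ | p 1 = 0} = 0 := by
    have := volume_setOf_aeval_eq_zero_of_ne (X 1) ![1, 1] (by simp)
    simpa using this
  have h2 : volume {p : Fin 2 → ℝ | (p 0 ^ 2 + p 1 ^ 2) ^ 2 = (b : ℝ) ^ 2} = 0 := by
    have := volume_setOf_aeval_eq_zero_of_ne ((X 0 ^ 2 + X 1 ^ 2) ^ 2 - C (b ^ 2)) ![0, 0]
      (by simp [hb])
    simpa [sub_eq_zero] using this
  refine measure_mono_null ?_ (measure_union_null (measure_union_null h0 h1) h2)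
  intro p hp
  simp only [mem_compl_iff, mem_union, mem_setOf_eq, not_or, not_and, not_lt] at hp
  by_cases hp0 : p 0 = 0
  · exact Or.inl (Or.inl hp0)
  by_cases hp1 : p 1 = 0
  · exact Or.inl (Or.inr hp1)
  exact Or.inr (le_antisymm (hp.1 hp0 hp1) (hp.2 hp0 hp1))

/-- The complement of `T = {Re ≠ a, Im ≠ 0}` is null. [folklore] -/
theorem volume_compl_T (a : ℚ) :
    volume ({q : Fin 2 → ℝ | q 0 ≠ (a : ℝ) ∧ q 1 ≠ 0})ᶜ = 0 := by
  have h0 : volume {q : Fin 2 → ℝ | q 0 = (a : ℝ)} = 0 := by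
    have := volume_setOf_aeval_eq_zero_of_ne (X 0 - C a) ![a + 1, 1] (by simp)
    simpa [sub_eq_zero] using this
  have h1 : volume {p : Fin 2 → ℝ | p 1 = 0} = 0 := by
    have := volume_setOf_aeval_eq_zero_of_ne (X 1) ![1, 1] (by simp)
    simpa using this
  refine measure_mono_null ?_ (measure_union_null h0 h1)
  intro q hq
  simp only [mem_compl_iff, mem_setOf_eq, not_and, ne_eq, not_not] at hq
  by_cases h : q 0 = a
  · exact Or.inl h
  · exact Or.inr (hq h)

/-- The two sheets are `ℚ`-semialgebraic. [cite: BochnakCosteRoy1998, §2.1] -/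
theorem isSemialgebraic_sheets (b : ℚ) :
    IsSemialgebraic ℚ {p : Fin 2 → ℝ | p 0 ≠ 0 ∧ p 1 ≠ 0 ∧ (b : ℝ) ^ 2 < (p 0 ^ 2 + p 1 ^ 2) ^ 2} ∧
      IsSemialgebraic ℚ
        {p : Fin 2 → ℝ | p 0 ≠ 0 ∧ p 1 ≠ 0 ∧ (p 0 ^ 2 + p 1 ^ 2) ^ 2 < (b : ℝ) ^ 2} := by
  have h0 : IsSemialgebraic ℚ {p : Fin 2 → ℝ | p 0 ≠ 0} := by
    simpa using isSemialgebraic_setOf_eval_ne_zero (k := ℚ) (R := ℝ) (X (0 : Fin 2))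
  have h1 : IsSemialgebraic ℚ {p : Fin 2 → ℝ | p 1 ≠ 0} := by
    simpa using isSemialgebraic_setOf_eval_ne_zero (k := ℚ) (R := ℝ) (X (1 : Fin 2))
  have h2 : IsSemialgebraic ℚ {p : Fin 2 → ℝ | (b : ℝ) ^ 2 < (p 0 ^ 2 + p 1 ^ 2) ^ 2} := by
    have h := isSemialgebraic_setOf_eval_lt (k := ℚ) (R := ℝ)
      (C (b ^ 2) : MvPolynomial (Fin 2) ℚ) ((X 0 ^ 2 + X 1 ^ 2) ^ 2)
    simp only [map_pow, map_add, MvPolynomial.aeval_X, MvPolynomial.aeval_C, eq_ratCast] at h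
    exact h
  have h3 : IsSemialgebraic ℚ {p : Fin 2 → ℝ | (p 0 ^ 2 + p 1 ^ 2) ^ 2 < (b : ℝ) ^ 2} := by
    have h := isSemialgebraic_setOf_eval_lt (k := ℚ) (R := ℝ)
      ((X 0 ^ 2 + X 1 ^ 2) ^ 2) (C (b ^ 2) : MvPolynomial (Fin 2) ℚ)
    simp only [map_pow, map_add, MvPolynomial.aeval_X, MvPolynomial.aeval_C, eq_ratCast] at h
    exact h
  exact ⟨by simpa only [setOf_and] using h0.inter (h1.inter h2),
    by simpa only [setOf_and] using h0.inter (h1.inter h3)⟩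

/-- `T = {Re ≠ a, Im ≠ 0}` is `ℚ`-semialgebraic. [cite: BochnakCosteRoy1998, §2.1] -/
theorem isSemialgebraic_T (a : ℚ) :
    IsSemialgebraic ℚ {q : Fin 2 → ℝ | q 0 ≠ (a : ℝ) ∧ q 1 ≠ 0} := by
  have h0 : IsSemialgebraic ℚ {q : Fin 2 → ℝ | q 0 ≠ (a : ℝ)} := by
    convert isSemialgebraic_setOf_eval_ne_zero (k := ℚ) (R := ℝ) (X (0 : Fin 2) - C a) using 1
    ext q
    simp only [mem_setOf_eq, map_sub, MvPolynomial.aeval_X, MvPolynomial.aeval_C, eq_ratCast,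
      sub_ne_zero]
  have h1 : IsSemialgebraic ℚ {p : Fin 2 → ℝ | p 1 ≠ 0} := by
    simpa using isSemialgebraic_setOf_eval_ne_zero (k := ℚ) (R := ℝ) (X (1 : Fin 2))
  simpa only [setOf_and] using h0.inter h1

/-! ### The area identity -/

/-- **`TwoIsogenyAreaIdentity`** (item stmt-KontsevichZagierPeriods-2879):
`∬_{ℝ²} dA/|x³+ax²+bx| = 2 ∬_{ℝ²} dA/|X³ − 2aX² + (a² − 4b)X|` as `[r] − 2•[r'] ∈ KZ.relations`.
Moves: discard the null set `{x y ((x²+y²)² − b²) = 0}` (rule 1a with null domains), split the rest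
into the sheets `|z|⁴ > b²` and `|z|⁴ < b²` (rule 1a), push each sheet forward along the x-map
`R(z) = z + a + b/z` of the 2-isogeny — injective on each sheet, onto `T = {Re ≠ a, Im ≠ 0}`, with
Jacobian `|R'|²` and `1/|P| = (1/|Q|∘R)·|R'|²` (rule 2, twice) — and restore the null set
`{Im w (Re w − a) = 0}` on the target (rule 1a). The hypothesis `a² − 4b ≠ 0` is not needed for the
derivation (it only makes the integrands integrable, which is part of the data `r, r'`).
[cite: SilvermanAEC2009, III.4.5] -/
theorem twoIsogenyAreaIdentity_proof :
    Summit.KontsevichZagierPeriods.KontsevichZagierPeriods.Theses.MultivaluedCoV.TwoIsogenyAreaIdentity := by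
  intro a b hb _hab r r' hdom hr hdom' hr'
  obtain ⟨e, he, he'⟩ := exists_equiv
  have hB0 : (b : ℝ) ≠ 0 := by exact_mod_cast hb
  obtain ⟨hsa0, hsa1⟩ := isSemialgebraic_sheets b
  have hTsa := isSemialgebraic_T a
  set σ₀ : Set (Fin 2 → ℝ) :=
    {p | p 0 ≠ 0 ∧ p 1 ≠ 0 ∧ (b : ℝ) ^ 2 < (p 0 ^ 2 + p 1 ^ 2) ^ 2} with hσ₀
  set σ₁ : Set (Fin 2 → ℝ) :=
    {p | p 0 ≠ 0 ∧ p 1 ≠ 0 ∧ (p 0 ^ 2 + p 1 ^ 2) ^ 2 < (b : ℝ) ^ 2} with hσ₁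
  set T : Set (Fin 2 → ℝ) := {q | q 0 ≠ (a : ℝ) ∧ q 1 ≠ 0} with hT
  set Φ : (Fin 2 → ℝ) → (Fin 2 → ℝ) :=
    fun q => e.symm (e q + ((a : ℝ) : ℂ) + ((b : ℝ) : ℂ) / e q) with hΦ
  -- the four auxiliary representations (restrictions of `r`, `r'`)
  have hsub : ∀ s : Set (Fin 2 → ℝ), s ⊆ r.domain := fun s => by
    rw [hdom]
    exact subset_univ s
  have hsub' : T ⊆ r'.domain := by
    rw [hdom']
    exact subset_univ T
  set rG := r.restrict (σ₀ ∪ σ₁) (hsa0.union hsa1) (hsub _) with hrG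
  set r0 := r.restrict σ₀ hsa0 (hsub _) with hr0
  set r1 := r.restrict σ₁ hsa1 (hsub _) with hr1
  set rT := r'.restrict T hTsa hsub' with hrT
  -- (1a) discard the null complement of the sheets, then split the sheets
  have h1 : KZ.of r - KZ.of rG ∈ KZ.relations := by
    refine r.of_sub_of_restrict_mem_relations (hsa0.union hsa1) (hsub _) ?_
    rw [hdom, ← compl_eq_univ_sdiff]
    exact volume_compl_sheets b hb
  have h2 : KZ.of rG - KZ.of r0 - KZ.of r1 ∈ KZ.relations := by
    refine KZ.domainAddRel_subset_relations
      ⟨2, rG, r0, r1, rfl, ?_, fun _ _ => rfl, fun _ _ => rfl, rfl⟩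
    have hdisj : r0.domain ∩ r1.domain = ∅ := by
      ext p
      simp only [mem_inter_iff, mem_empty_iff_false, iff_false, not_and]
      rintro ⟨-, -, hp⟩ ⟨-, -, hp'⟩
      exact lt_asymm hp hp'
    rw [hdisj, measure_empty]
  -- (1a) on the target: `[r'] ≡ [r' | T]`
  have h5 : KZ.of r' - KZ.of rT ∈ KZ.relations := by
    refine r'.of_sub_of_restrict_mem_relations hTsa hsub' ?_
    rw [hdom', ← compl_eq_univ_sdiff]
    exact volume_compl_T a
  -- rule (2) data: derivative with Jacobian `‖R'‖²`
  have hder : ∀ p : Fin 2 → ℝ, ∃ L : (Fin 2 → ℝ) →L[ℝ] (Fin 2 → ℝ), p 0 ≠ 0 →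
      HasFDerivAt Φ L p ∧ L.det = ‖1 - ((b : ℝ) : ℂ) / e p ^ 2‖ ^ 2 := by
    intro p
    by_cases hp : p 0 = 0
    · exact ⟨0, fun h => (h hp).elim⟩
    · obtain ⟨L, hL⟩ := hasFDerivAt_Phi e ((a : ℝ) : ℂ) ((b : ℝ) : ℂ) (equiv_ne_zero e he hp)
      exact ⟨L, fun _ => hL⟩
  choose Φ' hΦ' using hder
  -- the integrands on the whole plane
  have hrp : ∀ p, r.integrand p =
      1 / ‖e p ^ 3 + ((a : ℝ) : ℂ) * e p ^ 2 + ((b : ℝ) : ℂ) * e p‖ := by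
    intro p
    rw [he p]
    exact hr (show p ∈ r.domain by rw [hdom]; exact mem_univ p)
  have hrp' : ∀ q, r'.integrand q = 1 / ‖e q ^ 3 - 2 * ((a : ℝ) : ℂ) * e q ^ 2 +
      (((a : ℝ) : ℂ) ^ 2 - 4 * ((b : ℝ) : ℂ)) * e q‖ := by
    intro q
    rw [he q]
    exact hr' (show q ∈ r'.domain by rw [hdom']; exact mem_univ q)
  -- the rule-(2) integrand identity on `{x ≠ 0, y ≠ 0}`
  have hint : ∀ p : Fin 2 → ℝ, p 0 ≠ 0 → p 1 ≠ 0 →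
      r.integrand p = r'.integrand (Φ p) * |(Φ' p).det| := by
    intro p hp0 hp1
    have hw : e p ≠ 0 := equiv_ne_zero e he hp0
    have hwb : e p ^ 2 ≠ ((b : ℝ) : ℂ) := by
      intro h
      have him : (e p ^ 2).im = 0 := by
        rw [h]
        exact Complex.ofReal_im _
      obtain ⟨hre, hime, -⟩ := equiv_re_im e he p
      rw [sq, Complex.mul_im, hre, hime] at him
      have : p 0 * p 1 = 0 := by linarith
      rcases mul_eq_zero.mp this with h' | h'
      exacts [hp0 h', hp1 h']
    have heΦ : e (Φ p) = e p + ((a : ℝ) : ℂ) + ((b : ℝ) : ℂ) / e p := by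
      simp only [hΦ]
      exact e.apply_symm_apply _
    rw [(hΦ' p hp0).2, abs_of_nonneg (sq_nonneg _), hrp p, hrp' (Φ p), heΦ]
    exact jacobian_identity ((a : ℝ) : ℂ) ((b : ℝ) : ℂ) hw hwb
  -- rule (2) on each sheet
  have h3 : KZ.of r0 - KZ.of rT ∈ KZ.relations := by
    refine KZ.changeOfVariablesRel_subset_relations ⟨2, r0, rT, Φ, Φ', ?_, ?_, ?_, ?_, ?_, rfl⟩
    · exact isSemialgebraicMapOn_Phi e he he' a b hsa0 fun p hp => hp.1
    · exact fun p hp => (hΦ' p hp.1).1.hasFDerivWithinAt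
    · exact (injOn_Phi e he (a : ℝ) (b : ℝ) hB0).1
    · exact ((image_Phi e he he' (a : ℝ) (b : ℝ) hB0).1).symm
    · exact fun p hp => hint p hp.1 hp.2.1
  have h4 : KZ.of r1 - KZ.of rT ∈ KZ.relations := by
    refine KZ.changeOfVariablesRel_subset_relations ⟨2, r1, rT, Φ, Φ', ?_, ?_, ?_, ?_, ?_, rfl⟩
    · exact isSemialgebraicMapOn_Phi e he he' a b hsa1 fun p hp => hp.1
    · exact fun p hp => (hΦ' p hp.1).1.hasFDerivWithinAt
    · exact (injOn_Phi e he (a : ℝ) (b : ℝ) hB0).2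
    · exact ((image_Phi e he he' (a : ℝ) (b : ℝ) hB0).2).symm
    · exact fun p hp => hint p hp.1 hp.2.1
  -- bookkeeping in the free abelian group
  have : KZ.of r - 2 • KZ.of r' = (KZ.of r - KZ.of rG) + (KZ.of rG - KZ.of r0 - KZ.of r1) +
      (KZ.of r0 - KZ.of rT) + (KZ.of r1 - KZ.of rT) - 2 • (KZ.of r' - KZ.of rT) := by
    abel
  rw [this]
  exact KZ.relations.sub_mem
    (KZ.relations.add_mem (KZ.relations.add_mem (KZ.relations.add_mem h1 h2) h3) h4)
    (KZ.relations.nsmul_mem h5 2)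

end Summit.KontsevichZagierPeriods.MultivaluedCoV.TwoIsogenyAreaIdentity

end
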